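import Summits.AtomisticToContinuum.Crystallization.Theses.PalmUnimodularRigidity
import Summits.AtomisticToContinuum.Crystallization.Theorems.MinimiserShells.Negative.LoadBearing
import Summits.AtomisticToContinuum.Crystallization.Theorems.MinimiserShells.Negative.Rootedness
import Summits.AtomisticToContinuum.Crystallization.Theorems.PalmUnimodularRigidityMinimiserShellsEquilibriumInLawAssembly
import Summits.AtomisticToContinuum.Crystallization.Theorems.LayeredLawsSelectHcp.Negative.FccModel
import Summits.AtomisticToContinuum.Crystallization.Theorems.PalmUnimodularRigidityMinimiserShellsEventTransferCell
import Summits.AtomisticToContinuum.Crystallization.Theorems.PalmUnimodularRigidityMinimiserShellsSlackEventTransferCell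
import Literature.Probability.Process.PointStationaryLaw
import Literature.MathematicalPhysics.StatisticalMechanics.RootEnergy
import Literature.MathematicalPhysics.StatisticalMechanics.MuGSC

/-!
# Slack event transfer: a slack-priced local event has probability at most `s / c`

Stub `stub_slackEventTransfer` (S8a) of line `equilibrium-in-law-surgery` (lead reshape r4), crux `MinimiserShells`
(stmt-AtomisticToContinuum-9225).

**Theorem (`measure_event_le_of_slackPricing`).**  Let `δ > 0` and let `P` be a point-stationary probability law on
rooted `δ`-hard-core configurations of `ℝ³` which is minimising (`E_P[h] ≤ e*`) and almost surely carried by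
configurations `count|S` with `K S` (any class `K`).  Let `E` be a measurable set of configurations ("the event, read
at the root") and suppose the deep pricing inequality WITH SLACK `s ≥ 0` and constants `L₀, R₀, c > 0` on CUBE
WINDOWS: for every `δ`-separated `S` with `K S`, every window `C = S ∩ Q`, `Q` a half-open cube of side `L ≥ L₀`,
and every `G ⊆ C` consisting of sites `y` at which the event holds
after re-rooting (`count|(S − y) ∈ E`) and which are `R₀`-deep in `C` (`S ∩ B̄(y, R₀) ⊆ C`), one has
`#C · e* + c · #G ≤ ½ ∑∑_{C} V_LJ + s · #C`.  Then `P E ≤ s / c`.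

Proof: the machine of `…EventTransfer` (r3, p116677) run on the slack cell inequality
`…SlackEventTransferCell.pointwise_cell_inequality_slack` (the cells of the random grid ARE half-open cubes of side
`L`, `cell_eq_box`): `P(E) · c L³ ≤ (6 CT + 6 c R₀) L² + s L³` for every mesh `L ≥ L₀` (`measure_event_mul_le_slack`);
divide by `c L³` and let `L → ∞`.  The r3 theorem is the case `s = 0`.  A
THRESHOLD pricing (deep-`E` fraction `≥ t` ⇒ excess energy density `≥ κ`) is a slack pricing with `c = κ`, `s = κ t`
(the free periodisation bound covers the windows below threshold), so `P(E) ≤ t` — this is how the reshape-r4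
transfer `stub_thresholdTransfer` kills the bad-shell event without any pricing constant.
-/

noncomputable section

open MeasureTheory ProbabilityTheory
open scoped ENNReal BigOperators Classical

namespace Summit.AtomisticToContinuum.Crystallization.Theorems.PalmUnimodularRigidityMinimiserShells.SlackEventTransfer

open Literature.Probability.Process (IsPointStationaryLaw IsRootedHardCore count_restrict_singleton_ne_zero_iff
  map_sub_count_restrict)
open Literature.MathematicalPhysics.StatisticalMechanics (lennardJones IsMuGSC UniformlyDiscrete)
open Summit.AtomisticToContinuum.Crystallization.Theses.PalmUnimodularRigidity (MinimiserShells UnimodularEnergyLowerBound)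
open Summit.AtomisticToContinuum.Crystallization.Theorems.MinimiserShells.Negative.LoadBearing
  (eStar meanRootEnergy GoodShell minimiserShells_iff)
open Summit.AtomisticToContinuum.Crystallization.Theorems.MinimiserShells.Negative.Rootedness (E3
  countable_of_separated)
open Summit.AtomisticToContinuum.Crystallization.Theorems.LayeredLawsSelectHcp.Negative.FccModel
  (set_eq_of_count_restrict_eq)
open Summit.AtomisticToContinuum.Crystallization.Theorems.PalmUnimodularRigidityMinimiserShells.EquilibriumInLaw.LfKernel
  (lfKernel lfKernel_count_restrict)
open Summit.AtomisticToContinuum.Crystallization.Theorems.PalmUnimodularRigidityMinimiserShells.EquilibriumInLaw.Phase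
  (cube cell depth measurableSet_cube measurableSet_cell zero_mem_cell finite_inter_cell measurable_depth depth_nonneg)
open Summit.AtomisticToContinuum.Crystallization.Theorems.PalmUnimodularRigidityMinimiserShells.EquilibriumInLaw.Lattice
  (latticeL depth_add_of_mem_latticeL volume_cube)
open Summit.AtomisticToContinuum.Crystallization.Theorems.PalmUnimodularRigidityMinimiserShells.EquilibriumInLaw.RootSums
  (Bδ Bδ_nonneg tailBound tailBound_nonneg CT CT_nonneg)
open Summit.AtomisticToContinuum.Crystallization.Theorems.PalmUnimodularRigidityMinimiserShells.EquilibriumInLaw.Cluster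
  (tsum_sdiff_coe_eq_sum_add_tsum)
open Summit.AtomisticToContinuum.Crystallization.Theorems.PalmUnimodularRigidityMinimiserShells.EquilibriumInLaw.CellAverage
  (reroot reroot_eq_map measurable_reroot cellAvg measurable_cellAvg measurable_cellAvgIntegrand lintegral_cellAvg_eq)
open Summit.AtomisticToContinuum.Crystallization.Theorems.PalmUnimodularRigidityMinimiserShells.EquilibriumInLaw.CellSums
  (hTilde Bshift eStar_add_Bshift_nonneg F₁ F₂ measurable_F₁ measurable_F₂ F₁_periodic F₂_periodic
  lintegral_cell_indicator count_restrict_cell cellAvg_count_restrict reroot_count_restrict F₁_reroot abs_tsum_le_Bδ)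
open Summit.AtomisticToContinuum.Crystallization.Theorems.PalmUnimodularRigidityMinimiserShells.EquilibriumInLaw.WindowReal
  (inter_closedBall_subset_cell neg_tailBound_le_tsum)
open Summit.AtomisticToContinuum.Crystallization.Theorems.PalmUnimodularRigidityMinimiserShells.EquilibriumInLaw.Assembly
  (setLIntegral_F₂_le volume_cube_le_deep_add lintegral_cellAvg_F₁ lintegral_cellAvg_F₂ lintegral_ofReal_hTilde_le)

open Summit.AtomisticToContinuum.Crystallization.Theorems.PalmUnimodularRigidityMinimiserShells.EventTransferCell
  (measurable_Fev Fev_periodic lintegral_cellAvg_Fev)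
open Summit.AtomisticToContinuum.Crystallization.Theorems.PalmUnimodularRigidityMinimiserShells.SlackEventTransferCell
  (pointwise_cell_inequality_slack)

/-! ## Integration against the law -/

/-- **The key inequality with slack**: for every grid size `L ≥ L₀`, `L > 0`,
`P(E) · ofReal(c L³) ≤ ofReal((6 CT + 6 c R₀) L² + s L³)`. -/
theorem measure_event_mul_le_slack {δ : ℝ} (hδ : 0 < δ) {P : Measure (Measure E3)} [IsProbabilityMeasure P]
    (hcore : ∀ᵐ μ ∂P, IsRootedHardCore δ μ) (hstat : IsPointStationaryLaw P) (hE : meanRootEnergy P ≤ eStar)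
    {K : Set E3 → Prop}
    (hK : ∀ᵐ μ ∂P, ∃ S : Set E3, μ = (Measure.count : Measure E3).restrict S ∧ K S)
    {Ev : Set (Measure E3)} (hEv : MeasurableSet Ev) {L₀ R₀ c s : ℝ} (hR₀ : 0 < R₀) (hc : 0 < c) (hs : 0 ≤ s)
    (hprice : ∀ S : Set E3, (∀ x ∈ S, ∀ z ∈ S, x ≠ z → δ ≤ dist x z) → K S →
      ∀ L : ℝ, L₀ ≤ L → ∀ a : Fin 3 → ℝ, ∀ C : Finset E3,
        (↑C : Set E3) = S ∩ {z : E3 | ∀ i, a i ≤ z i ∧ z i < a i + L} → ∀ G : Finset E3, G ⊆ C →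
        (∀ y ∈ G, (Measure.count : Measure E3).restrict ((fun z => z - y) '' S) ∈ Ev ∧
          S ∩ Metric.closedBall y R₀ ⊆ ↑C) →
        (C.card : ℝ) * eStar + c * G.card ≤ (∑ x ∈ C, ∑ z ∈ C, lennardJones (dist x z)) / 2 + s * C.card)
    {L : ℝ} (hL : 0 < L) (hL₀ : L₀ ≤ L) :
    P Ev * ENNReal.ofReal (c * L ^ 3) ≤ ENNReal.ofReal ((6 * CT δ + 6 * c * R₀) * L ^ 2 + s * L ^ 3) := by
  set Vg := (volume.restrict (cube L)) {u : E3 | R₀ < depth L u} with hVg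
  set A := ENNReal.ofReal (eStar + Bshift δ) * volume (cube L) with hA
  set Z := ENNReal.ofReal s * volume (cube L) with hZ
  have hAtop : A ≠ ∞ := by
    rw [hA, volume_cube hL.le]; exact ENNReal.mul_ne_top ENNReal.ofReal_ne_top ENNReal.ofReal_ne_top
  -- the pointwise inequality holds almost surely
  have hpwae : ∀ᵐ μ ∂P, A + ENNReal.ofReal c * cellAvg L (fun (μ : Measure E3) (u : E3) => Ev.indicator (1 : Measure E3 → ℝ≥0∞) μ * {u : E3 | R₀ < depth L u}.indicator (1 : E3 → ℝ≥0∞) u) μ ≤ cellAvg L (F₁ δ) μ + cellAvg L (F₂ δ L) μ + Z := by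
    filter_upwards [hcore, hK] with μ hμ hKμ
    obtain ⟨S, h0, hsep, rfl⟩ := hμ
    obtain ⟨T, hT, hKT⟩ := hKμ
    obtain rfl : S = T := set_eq_of_count_restrict_eq hT
    exact pointwise_cell_inequality_slack hδ h0 hsep hEv hc hs (hprice S hsep hKT) hL hL₀
  -- integrate the pointwise inequality
  have hint : A + ENNReal.ofReal c * ∫⁻ μ, cellAvg L (fun (μ : Measure E3) (u : E3) => Ev.indicator (1 : Measure E3 → ℝ≥0∞) μ * {u : E3 | R₀ < depth L u}.indicator (1 : E3 → ℝ≥0∞) u) μ ∂P ≤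
      ∫⁻ μ, cellAvg L (F₁ δ) μ ∂P + ∫⁻ μ, cellAvg L (F₂ δ L) μ ∂P + Z := by
    have h3 := measurable_cellAvg (L := L) (measurable_Fev L R₀ hEv)
    have h1 := measurable_cellAvg (L := L) (measurable_F₁ δ)
    calc A + ENNReal.ofReal c * ∫⁻ μ, cellAvg L (fun (μ : Measure E3) (u : E3) => Ev.indicator (1 : Measure E3 → ℝ≥0∞) μ * {u : E3 | R₀ < depth L u}.indicator (1 : E3 → ℝ≥0∞) u) μ ∂P
        = ∫⁻ μ, (A + ENNReal.ofReal c * cellAvg L (fun (μ : Measure E3) (u : E3) => Ev.indicator (1 : Measure E3 → ℝ≥0∞) μ * {u : E3 | R₀ < depth L u}.indicator (1 : E3 → ℝ≥0∞) u) μ) ∂P := by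
          rw [lintegral_add_left measurable_const, lintegral_const, measure_univ, mul_one,
            lintegral_const_mul _ h3]
      _ ≤ ∫⁻ μ, (cellAvg L (F₁ δ) μ + cellAvg L (F₂ δ L) μ + Z) ∂P := lintegral_mono_ae hpwae
      _ = _ := by
          rw [lintegral_add_right _ measurable_const, lintegral_const, measure_univ, mul_one, lintegral_add_left h1]
  -- evaluate the three expectations
  rw [lintegral_cellAvg_F₁ hL hδ hcore hstat, lintegral_cellAvg_F₂ hL hδ hcore hstat,
    lintegral_cellAvg_Fev hL hδ hcore hstat R₀ hEv] at hint
  have hB1 := lintegral_ofReal_hTilde_le hδ hcore hE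
  have hB2 := setLIntegral_F₂_le (δ := δ) hL (0 : Measure E3)
  have hB3 := volume_cube_le_deep_add hL hR₀.le
  -- `A + c P(E) Vg ≤ A + 6L² CT + Z`
  have hkey : ENNReal.ofReal c * (P Ev * Vg) ≤ ENNReal.ofReal (6 * L ^ 2) * ENNReal.ofReal (CT δ) + Z := by
    have h' : A + ENNReal.ofReal c * (P Ev * Vg) ≤ A + (ENNReal.ofReal (6 * L ^ 2) * ENNReal.ofReal (CT δ) + Z) :=
      calc A + ENNReal.ofReal c * (P Ev * Vg) ≤ (∫⁻ μ, ENNReal.ofReal (hTilde μ + Bshift δ) ∂P) * volume (cube L) +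
            (∫⁻ u in cube L, F₂ δ L (0 : Measure E3) u) + Z := hint
        _ ≤ A + ENNReal.ofReal (6 * L ^ 2) * ENNReal.ofReal (CT δ) + Z :=
            add_le_add (add_le_add (mul_le_mul' hB1 le_rfl) hB2) le_rfl
        _ = A + (ENNReal.ofReal (6 * L ^ 2) * ENNReal.ofReal (CT δ) + Z) := add_assoc _ _ _
    exact (ENNReal.add_le_add_iff_left hAtop).1 h'
  -- use `vol(cube) ≤ Vg + 6 R₀ L²` and `P(E) ≤ 1`
  have hPE1 : P Ev ≤ 1 := prob_le_one
  have hZ' : Z = ENNReal.ofReal (s * L ^ 3) := by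
    rw [hZ, volume_cube hL.le, ← ENNReal.ofReal_mul hs]
  calc P Ev * ENNReal.ofReal (c * L ^ 3) = ENNReal.ofReal c * (P Ev * volume (cube L)) := by
        rw [ENNReal.ofReal_mul hc.le, volume_cube hL.le]; ring
    _ ≤ ENNReal.ofReal c * (P Ev * (Vg + ENNReal.ofReal (6 * R₀ * L ^ 2))) := by gcongr
    _ = ENNReal.ofReal c * (P Ev * Vg) + ENNReal.ofReal c * P Ev * ENNReal.ofReal (6 * R₀ * L ^ 2) := by ring
    _ ≤ ENNReal.ofReal (6 * L ^ 2) * ENNReal.ofReal (CT δ) + Z + ENNReal.ofReal c * 1 * ENNReal.ofReal (6 * R₀ * L ^ 2) := by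
        gcongr
    _ = ENNReal.ofReal ((6 * CT δ + 6 * c * R₀) * L ^ 2 + s * L ^ 3) := by
        rw [mul_one, hZ', ← ENNReal.ofReal_mul (by positivity), ← ENNReal.ofReal_mul hc.le,
          add_right_comm, ← ENNReal.ofReal_add (by have := CT_nonneg δ; positivity) (by positivity),
          ← ENNReal.ofReal_add (by have := CT_nonneg δ; positivity) (by positivity)]
        congr 1
        ring

/-! ## The conclusion: `P(E) ≤ s / c` -/

/-- **Slack event transfer theorem.**  Under a minimising point-stationary law on rooted `δ`-hard-core
configurations that is a.s. carried by a class `K`, a measurable event whose deep sites are linearly priced on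
large cube windows of `K`-configurations up to a slack `s` per site of the window has probability `≤ s / c`. -/
theorem measure_event_le_of_slackPricing {δ : ℝ} (hδ : 0 < δ) {P : Measure (Measure E3)}
    [IsProbabilityMeasure P]
    (hcore : ∀ᵐ μ ∂P, IsRootedHardCore δ μ) (hstat : IsPointStationaryLaw P) (hE : meanRootEnergy P ≤ eStar)
    {K : Set E3 → Prop}
    (hK : ∀ᵐ μ ∂P, ∃ S : Set E3, μ = (Measure.count : Measure E3).restrict S ∧ K S)
    {Ev : Set (Measure E3)} (hEv : MeasurableSet Ev) {L₀ R₀ c s : ℝ} (hR₀ : 0 < R₀) (hc : 0 < c) (hs : 0 ≤ s)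
    (hprice : ∀ S : Set E3, (∀ x ∈ S, ∀ z ∈ S, x ≠ z → δ ≤ dist x z) → K S →
      ∀ L : ℝ, L₀ ≤ L → ∀ a : Fin 3 → ℝ, ∀ C : Finset E3,
        (↑C : Set E3) = S ∩ {z : E3 | ∀ i, a i ≤ z i ∧ z i < a i + L} → ∀ G : Finset E3, G ⊆ C →
        (∀ y ∈ G, (Measure.count : Measure E3).restrict ((fun z => z - y) '' S) ∈ Ev ∧
          S ∩ Metric.closedBall y R₀ ⊆ ↑C) →
        (C.card : ℝ) * eStar + c * G.card ≤ (∑ x ∈ C, ∑ z ∈ C, lennardJones (dist x z)) / 2 + s * C.card) :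
    P Ev ≤ ENNReal.ofReal (s / c) := by
  set Kc : ℝ := (6 * CT δ + 6 * c * R₀) / c with hKc
  have hK0 : 0 ≤ Kc := by have := CT_nonneg δ; positivity
  -- for every `L ≥ L₀`, `L > 0`: `P(E) ≤ ofReal (Kc / L + s / c)`
  have hdiv : ∀ {L : ℝ}, 0 < L → L₀ ≤ L → P Ev ≤ ENNReal.ofReal (Kc / L + s / c) := by
    intro L hL hL₀
    have hmain := measure_event_mul_le_slack hδ hcore hstat hE hK hEv hR₀ hc hs hprice hL hL₀
    have hcL : 0 < c * L ^ 3 := by positivity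
    have h1 : P Ev ≤ ENNReal.ofReal ((6 * CT δ + 6 * c * R₀) * L ^ 2 + s * L ^ 3) / ENNReal.ofReal (c * L ^ 3) := by
      rw [ENNReal.le_div_iff_mul_le (Or.inl ((ENNReal.ofReal_pos.2 hcL).ne')) (Or.inl ENNReal.ofReal_ne_top)]
      exact hmain
    rw [← ENNReal.ofReal_div_of_pos hcL] at h1
    have heq : ((6 * CT δ + 6 * c * R₀) * L ^ 2 + s * L ^ 3) / (c * L ^ 3) = Kc / L + s / c := by
      rw [hKc]; field_simp
    rwa [heq] at h1
  refine ENNReal.le_of_forall_pos_le_add fun ε hε _ => ?_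
  set L : ℝ := max L₀ (Kc / ε + 1) with hLdef
  have hεr : (0 : ℝ) < ε := hε
  have hL1 : 0 < Kc / ε + 1 := by positivity
  have hL : 0 < L := lt_of_lt_of_le hL1 (le_max_right _ _)
  have hL₀ : L₀ ≤ L := le_max_left _ _
  have hlt : Kc / L ≤ ε := by
    rw [div_le_iff₀ hL]
    have h1 : Kc ≤ (ε : ℝ) * (Kc / ε + 1) := by
      rw [mul_add, mul_div_cancel₀ _ hεr.ne', mul_one]
      linarith
    have h2 : (ε : ℝ) * (Kc / ε + 1) ≤ (ε : ℝ) * L := mul_le_mul_of_nonneg_left (le_max_right _ _) hεr.le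
    linarith
  calc P Ev ≤ ENNReal.ofReal (Kc / L + s / c) := hdiv hL hL₀
    _ ≤ ENNReal.ofReal (Kc / L) + ENNReal.ofReal (s / c) := ENNReal.ofReal_add_le
    _ ≤ (ε : ℝ≥0∞) + ENNReal.ofReal (s / c) := by
        gcongr
        rw [← ENNReal.ofReal_coe_nnreal]
        exact ENNReal.ofReal_le_ofReal hlt
    _ = ENNReal.ofReal (s / c) + ε := add_comm _ _

/-- **stub_slackEventTransfer** (S8a of line `equilibrium-in-law-surgery`, reshape r4): the slack event transfer
`measure_event_le_of_slackPricing`, in the registered closed form. -/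
theorem stub_slackEventTransfer :
    ∀ δ : ℝ, 0 < δ → ∀ P : Measure (Measure (EuclideanSpace ℝ (Fin 3))), IsProbabilityMeasure P →
      (∀ᵐ μ ∂P, IsRootedHardCore δ μ) → IsPointStationaryLaw P → meanRootEnergy P ≤ eStar →
      ∀ K : Set (EuclideanSpace ℝ (Fin 3)) → Prop,
      (∀ᵐ μ ∂P, ∃ S : Set (EuclideanSpace ℝ (Fin 3)),
        μ = (Measure.count : Measure (EuclideanSpace ℝ (Fin 3))).restrict S ∧ K S) →
      ∀ Ev : Set (Measure (EuclideanSpace ℝ (Fin 3))), MeasurableSet Ev →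
      ∀ L₀ R₀ c s : ℝ, 0 < L₀ → 0 < R₀ → 0 < c → 0 ≤ s →
      (∀ S : Set (EuclideanSpace ℝ (Fin 3)), (∀ x ∈ S, ∀ z ∈ S, x ≠ z → δ ≤ dist x z) → K S →
        ∀ L : ℝ, L₀ ≤ L → ∀ a : Fin 3 → ℝ, ∀ C : Finset (EuclideanSpace ℝ (Fin 3)),
        (↑C : Set (EuclideanSpace ℝ (Fin 3))) = S ∩ {z : EuclideanSpace ℝ (Fin 3) | ∀ i, a i ≤ z i ∧ z i < a i + L} →
        ∀ G : Finset (EuclideanSpace ℝ (Fin 3)), G ⊆ C →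
          (∀ y ∈ G, (Measure.count : Measure (EuclideanSpace ℝ (Fin 3))).restrict ((fun z => z - y) '' S) ∈ Ev ∧
            S ∩ Metric.closedBall y R₀ ⊆ ↑C) →
          (C.card : ℝ) * eStar + c * G.card ≤ (∑ x ∈ C, ∑ z ∈ C, lennardJones (dist x z)) / 2 + s * C.card) →
      P Ev ≤ ENNReal.ofReal (s / c) :=
  fun _ hδ _ _ hcore hstat hE _ hK _ hEv _ _ _ _ _ hR₀ hc hs hprice =>
    measure_event_le_of_slackPricing hδ hcore hstat hE hK hEv hR₀ hc hs hprice

end Summit.AtomisticToContinuum.Crystallization.Theorems.PalmUnimodularRigidityMinimiserShells.SlackEventTransfer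

end
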